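import Mathlib

/-!
# Sketch (stub-ideation k4 g15, family 3 «assume the opposite») for `stub_cmLambdaLower` = RSL_g (stmt-BirchSwinnertonDyer-22608)
# under crux (R≥)ᵖ `ResidualThetaCountLowerPureAtTwo` (stmt-BirchSwinnertonDyer-26074), route RTT — THE ENTRY CURRENCY IS FORCED

Object: the binder `hDH : ∀ t : P, pair t = 0 → ∃ a : ℤ_[2], a ≠ 0 ∧ ∃ x : H, a • t = locd x` of
`LambdaLowerBoundO.le_finrank_characterModule_of_intDualityData` (p679392, N5) at the moment the split GLUE `onePairSupply_of_split`
(STUB-PLAN rev 18 pt 2, S76) CHOOSES `P`.  S2 `stub_plusColemanO` (v2c, V2A-PINS §6) delivers the SIGNED pair on the UNREDUCED functional dual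
`𝔉₂ := ((Fin n → TP) →+ ℤ_[2])` with (KER) `(∀ i, col (t ∘ single i) = 0) → pair₂ t = 0`; `locd₂ : I.H →+ 𝔉₂` (p679036) is unreduced too.

Family-3 move: ASSUME THE OPPOSITE of the g16 cut — feed N5 with `P := 𝔉₂ × P_S`, `pair := pair₂ ⊕ pins`, `locd := (locd₂, locd_S)` (critic V64's
literal words «P := 𝔉₂ ⊕ P_{S₀}, pair := the pinned 2-adic family + the S₀ pins»).  §A PROVES this is REFUTABLE from the road's own facts:
(KER) + «`locd₂ x ∈ ker colⁿ ⇒ x = 0`» (V2A §5 (c) `𝔖⁺(T) = 0`; K0b-free variant: `⇒ x` is `Λ_𝒪`-torsion, k1-g12 `ker_iff_torsion`) + (DH) force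
`ker colⁿ = ⊥`, against ONE nonzero element of `ker col = ann(E⁺_∞)` (print: `H¹_+ = ker Col⁺ ≅ Λ`, [Kobayashi2003] §8, [LeiLoefflerZerbes2010]
§5.2.2 / Prop. 5.16).  Equivalently (A5): the coarsening hypothesis `hπker : ann(E⁺) × 0 ≤ ker π` of `CharIdealLambda.deepHalfSigma_of_relaxed`
(g16 `…RelaxedDeepHalf`) is not only sufficient but NECESSARY — A5′/A5″ prove exactly that in the tree's binders (`c₂ cS loc₂ locS Eplus Sg hSg π
pair hcompat loc'`; A5″ is the K0b-free form, S74/S75).  §B is the socket the glue then needs and nobody typed: the `pair`/`hcompat` BINDERS of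
`deepHalfSigma_of_relaxed` are CONSTRUCTED by descent along `π` (B8 linear descent; B9 `exists_pair_hcompat` for any onto `π` whose kernel pairs
to zero with the strict classes; B10/B11: `ker π ≤ ann(Eplus) × 0` suffices, so with A5′ the admissible kernels are pinned to `ann(Eplus) × 0`;
B12 packages the forced currency `π := mk × id : P₀ × P_S ↠ (P₀ ⧸ ann(Eplus)) × P_S` — onto, `hπker`, `pair`, `hcompat` all discharged); B1–B7 are
the additive-map forms matching S2's (KER)/(LIN) clauses literally (`pair₂ = pairBar ∘ colⁿ`, unique, (LIN)/(EH)/(ORTH) preserved, `colⁿ` onto).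
§C: on the reduced currency the 2-adic COUNT/finiteness are S3's `(i_D)`/`(nz⁺)` on `Q = Λⁿ ⧸ span (𝒸 '' Λ_𝒪 z)` by isomorphism theorems, and
coarsening further can only LOWER the count (C5) — `ker π = ann(Eplus) × 0 = ker colⁿ × 0` is the unique optimal admissible currency.

Pure module algebra (instantiate `R := ℤ_[2]`, `S := Λ_𝒪`, `K' := ℚ_[2]`); THEOREMS ONLY, no `sorry`, Mathlib only.  The product-quotient PUSH is NOT
repeated here (in the tree: `Theorems.ColemanSideInjective.finite_and_count_prodQuot`, credit k3-g12).  Nothing here is about curves or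
`L`-functions; BSD is NOT proved by any of this; RSL_g 22608 and (R≥)ᵖ 26074 stay OPEN.
-/

set_option autoImplicit false
set_option linter.dupNamespace false

namespace Summit.BirchSwinnertonDyer.BirchSwinnertonDyer.Cruxes.ResidualThetaCountLowerPureAtTwo.SideaK4G15

open Function

universe u u' v w x

/-! ## §A  The no-go: (KER) + `𝔖⁺ = 0` + (DH) force the (KER)-kernel to vanish — the unreduced signed currency is refutable -/

section NoGo

variable {R : Type u} [Ring R] {P : Type v} [AddCommGroup P] [Module R P]
  {H : Type w} [AddCommGroup H] {M : Type x} [AddCommGroup M]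

/-- **A1 (abstract no-go).** If `pair` kills a submodule `N` (S2 (KER)), the deep half (DH) holds for `(pair, locd)`, the strict part
`{x | locd x ∈ N}` is zero, and `P` has no `R`-torsion, then `N = ⊥`. -/
theorem eq_bot_of_deepHalf [NoZeroSMulDivisors R P] (pair : P →+ M) (locd : H →+ P) (N : Submodule R P)
    (hKER : ∀ t ∈ N, pair t = 0)
    (hDH : ∀ t : P, pair t = 0 → ∃ a : R, a ≠ 0 ∧ ∃ x : H, a • t = locd x)
    (hS : ∀ x : H, locd x ∈ N → x = 0) : N = ⊥ := by
  refine (Submodule.eq_bot_iff N).2 fun t ht ↦ ?_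
  obtain ⟨a, ha, x, hx⟩ := hDH t (hKER t ht)
  have hxN : locd x ∈ N := hx ▸ N.smul_mem a ht
  have hx0 : x = 0 := hS x hxN
  rw [hx0, map_zero] at hx
  exact (eq_zero_or_eq_zero_of_smul_eq_zero hx).resolve_left ha

variable {F : Type v} [AddCommGroup F] [Module R F] {PS : Type v} [AddCommGroup PS] [Module R PS]

/-- **A2 (product currency `P = 𝔉 × P_S`, the literal V64 instantiation).** `pair` kills `N₂ × 0` (S2 (KER), `N₂ = ker colⁿ`), (DH) holds for
`locd = (locd₂, locd_S)`, and `𝔖⁺ = 0` in the form «`locd₂ x ∈ N₂ → x = 0`» (V2A §5 (c)).  Then `N₂ = ⊥`.  Only the 2-ADIC factor needs to be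
torsion-free (it is: maps into `ℤ₂`, A6), `P_S` may have torsion. -/
theorem fst_eq_bot_of_deepHalf [NoZeroSMulDivisors R F] (pair : F × PS →+ M) (locd₂ : H →+ F) (locdS : H →+ PS)
    (N₂ : Submodule R F)
    (hKER : ∀ t ∈ N₂, pair (t, 0) = 0)
    (hDH : ∀ t : F × PS, pair t = 0 → ∃ a : R, a ≠ 0 ∧ ∃ x : H, a • t = (locd₂ x, locdS x))
    (hS : ∀ x : H, locd₂ x ∈ N₂ → x = 0) : N₂ = ⊥ := by
  refine (Submodule.eq_bot_iff N₂).2 fun t ht ↦ ?_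
  obtain ⟨a, ha, x, hx⟩ := hDH (t, 0) (hKER t ht)
  have h1 : a • t = locd₂ x := by simpa using congrArg Prod.fst hx
  have hxN : locd₂ x ∈ N₂ := h1 ▸ N₂.smul_mem a ht
  have hx0 : x = 0 := hS x hxN
  rw [hx0, map_zero] at h1
  exact (eq_zero_or_eq_zero_of_smul_eq_zero h1).resolve_left ha

/-- **A3 (K0b-free variant; STUB-PLAN rev 18 S74/S75).** Without `Λ_𝒪`-torsion-freeness of `I.H`, k1-g12's `ker_iff_torsion` gives only
«`𝒸 x = 0 ⇒ x` is `S`-torsion» (`S = Λ_𝒪`).  If `locd₂` is `S`-semilinear (LIN-X / LIN-C₀) and `𝔉` has no `S`-torsion either (print: `H¹_Iw(ℚ₂, T)`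
is `Λ`-torsion-free since `E(ℚ_{2,∞})[2^∞] = 0`), the conclusion `N₂ = ⊥` persists. -/
theorem fst_eq_bot_of_deepHalf_of_torsion {S : Type u'} [Ring S] [Module S F] [Module S H] [SMulCommClass S R F]
    [NoZeroSMulDivisors R F] [NoZeroSMulDivisors S F] (pair : F × PS →+ M) (locd₂ : H →+ F) (locdS : H →+ PS)
    (hlocd₂ : ∀ (b : S) (x : H), locd₂ (b • x) = b • locd₂ x) (N₂ : Submodule R F)
    (hKER : ∀ t ∈ N₂, pair (t, 0) = 0)
    (hDH : ∀ t : F × PS, pair t = 0 → ∃ a : R, a ≠ 0 ∧ ∃ x : H, a • t = (locd₂ x, locdS x))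
    (hS : ∀ x : H, locd₂ x ∈ N₂ → ∃ b : S, b ≠ 0 ∧ b • x = 0) : N₂ = ⊥ := by
  refine (Submodule.eq_bot_iff N₂).2 fun t ht ↦ ?_
  obtain ⟨a, ha, x, hx⟩ := hDH (t, 0) (hKER t ht)
  have h1 : a • t = locd₂ x := by simpa using congrArg Prod.fst hx
  have hxN : locd₂ x ∈ N₂ := h1 ▸ N₂.smul_mem a ht
  obtain ⟨b, hb, hbx⟩ := hS x hxN
  have h2 : b • (a • t) = 0 := by rw [h1, ← hlocd₂, hbx, map_zero]
  rw [smul_comm] at h2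
  have h3 : b • t = 0 := (eq_zero_or_eq_zero_of_smul_eq_zero h2).resolve_left ha
  exact (eq_zero_or_eq_zero_of_smul_eq_zero h3).resolve_left hb

/-- **A4 (the trap, as a refutation).** ONE nonzero `t ∈ N₂` (print: `ker Col⁺ = ann(E⁺_∞) ≅ Λ ≠ 0`), (KER) and `𝔖⁺ = 0` make the N5 binder
`hDH` FALSE for the signed pair on the unreduced `𝔉 × P_S`. -/
theorem not_deepHalf_of_exists_mem_ne_zero [NoZeroSMulDivisors R F] (pair : F × PS →+ M) (locd₂ : H →+ F) (locdS : H →+ PS)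
    (N₂ : Submodule R F)
    (hKER : ∀ t ∈ N₂, pair (t, 0) = 0)
    (hS : ∀ x : H, locd₂ x ∈ N₂ → x = 0)
    (ht : ∃ t ∈ N₂, t ≠ 0) :
    ¬ (∀ t : F × PS, pair t = 0 → ∃ a : R, a ≠ 0 ∧ ∃ x : H, a • t = (locd₂ x, locdS x)) := by
  intro hDH
  obtain ⟨t, htN, ht0⟩ := ht
  exact ht0 ((Submodule.eq_bot_iff N₂).1 (fst_eq_bot_of_deepHalf pair locd₂ locdS N₂ hKER hDH hS) t htN)

/-- A4, K0b-free. -/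
theorem not_deepHalf_of_exists_mem_ne_zero_of_torsion {S : Type u'} [Ring S] [Module S F] [Module S H] [SMulCommClass S R F]
    [NoZeroSMulDivisors R F] [NoZeroSMulDivisors S F] (pair : F × PS →+ M) (locd₂ : H →+ F) (locdS : H →+ PS)
    (hlocd₂ : ∀ (b : S) (x : H), locd₂ (b • x) = b • locd₂ x) (N₂ : Submodule R F)
    (hKER : ∀ t ∈ N₂, pair (t, 0) = 0)
    (hS : ∀ x : H, locd₂ x ∈ N₂ → ∃ b : S, b ≠ 0 ∧ b • x = 0)
    (ht : ∃ t ∈ N₂, t ≠ 0) :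
    ¬ (∀ t : F × PS, pair t = 0 → ∃ a : R, a ≠ 0 ∧ ∃ x : H, a • t = (locd₂ x, locdS x)) := by
  intro hDH
  obtain ⟨t, htN, ht0⟩ := ht
  exact ht0 ((Submodule.eq_bot_iff N₂).1
    (fst_eq_bot_of_deepHalf_of_torsion pair locd₂ locdS hlocd₂ N₂ hKER hDH hS) t htN)

end NoGo

section Necessary

variable {A : Type u} [CommRing A] {P₀ : Type v} [AddCommGroup P₀] [Module A P₀] {PS : Type v} [AddCommGroup PS] [Module A PS]
  {P : Type v} [AddCommGroup P] [Module A P] {H : Type w} [AddCommGroup H] {M : Type x} [AddCommGroup M]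

/-- **A5 (`hπker` is NECESSARY).** In the currency of g16 `CharIdealLambda.deepHalfSigma_of_relaxed`: a coarsening `π : P₀ × P_S → P` (so
`locd = π ∘ loc'`) into an `A`-torsion-free `P` on which (DH) holds for a pair killing `π (N₂ × 0)` ((KER) transported by `hcompat`), with the
strict part «`π (loc' x) ∈ π (N₂ × 0) → x = 0`» zero, must kill `N₂ × 0`.  So `ann(E⁺) × 0 ≤ ker π` is forced: the cut `P := 𝔉₂ ⧸ ann((⨆E⁺)ⁿ) × P_S`
of `SKELETON-V2-CUT-g16` is the FINEST admissible currency, not a choice. -/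
theorem forall_pi_inl_eq_zero_of_deepHalf [NoZeroSMulDivisors A P] (π : (P₀ × PS) →ₗ[A] P) (pair : P →+ M) (loc' : H →+ P₀ × PS)
    (N₂ : Submodule A P₀)
    (hKER : ∀ t ∈ N₂, pair (π (t, 0)) = 0)
    (hDH : ∀ z : P, pair z = 0 → ∃ a : A, a ≠ 0 ∧ ∃ x : H, a • z = π (loc' x))
    (hS : ∀ x : H, π (loc' x) ∈ (N₂.prod ⊥).map π → x = 0) :
    ∀ t ∈ N₂, π (t, 0) = 0 := by
  have hbot := eq_bot_of_deepHalf pair (π.toAddMonoidHom.comp loc') ((N₂.prod ⊥).map π) ?_ ?_ ?_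
  · intro t ht
    exact (Submodule.eq_bot_iff _).1 hbot _ (Submodule.mem_map_of_mem (Submodule.mem_prod.2 ⟨ht, (Submodule.mem_bot A).2 rfl⟩))
  · rintro _ ⟨y, hy, rfl⟩
    obtain ⟨hy1, hy2⟩ := Submodule.mem_prod.1 hy
    have : y = (y.1, 0) := Prod.ext rfl ((Submodule.mem_bot A).1 hy2)
    rw [this]
    exact hKER y.1 hy1
  · intro z hz
    simpa using hDH z hz
  · intro x hx
    exact hS x (by simpa using hx)

end Necessary

section NecessaryTree

/-! ### A5 in the TREE's currency (binders of `CharIdealLambda.deepHalfSigma_of_relaxed` verbatim: `c₂ cS loc₂ locS Eplus Sg hSg π pair hcompat loc'`).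
(KER) for `pair ∘ π` on `ann(Eplus) × 0` is DERIVED from `hcompat` + `hSg` (strict classes are plus at 2); torsion-freeness is asked only of
the elements `π (t, 0)` (the 2-adic share `Λⁿ`; `P_S` may have torsion). -/

variable {A : Type u} [CommRing A] {P₀ PS D₂ DS P H SelRel : Type v}
  [AddCommGroup P₀] [Module A P₀] [AddCommGroup PS] [Module A PS] [AddCommGroup D₂] [Module A D₂]
  [AddCommGroup DS] [Module A DS] [AddCommGroup P] [Module A P] [AddCommGroup H] [Module A H]
  [AddCommGroup SelRel] [Module A SelRel]

/-- **A5′ (`hπker` is NECESSARY, tree currency).** If (DH) holds for the coarsened `pair`/`locd = π ∘ loc'` fed to N5, the 2-adic images `π (t,0)`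
are `A`-torsion-free, and the strict part over `π (ann(Eplus) × 0)` vanishes (`𝔖⁺ = 0`, V2A §5 (c)), then `π` kills `ann(Eplus) × 0` — i.e. the
hypothesis `hπker` of `deepHalfSigma_of_relaxed` was forced. -/
theorem hπker_necessary
    (c₂ : P₀ →ₗ[A] CharacterModule D₂) (cS : PS →ₗ[A] CharacterModule DS)
    (loc₂ : SelRel →ₗ[A] D₂) (locS : SelRel →ₗ[A] DS) (Eplus : Submodule A D₂)
    (Sg : Submodule A SelRel) (hSg : ∀ s, s ∈ Sg ↔ loc₂ s ∈ Eplus)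
    (π : (P₀ × PS) →ₗ[A] P) (pair : P →ₗ[A] CharacterModule Sg)
    (hcompat : ∀ (t : P₀ × PS) (s : Sg), pair (π t) s = c₂ t.1 (loc₂ s) + cS t.2 (locS s))
    (loc' : H →ₗ[A] P₀ × PS)
    (hTF : ∀ (a : A) (t : P₀), a ≠ 0 → a • π (t, 0) = 0 → π (t, 0) = 0)
    (hDH : ∀ z : P, pair z = 0 → ∃ a : A, a ≠ 0 ∧ ∃ x : H, a • z = π (loc' x))
    (hS : ∀ (x : H) (t : P₀), (∀ e ∈ Eplus, c₂ t e = 0) → π (loc' x) = π (t, 0) → x = 0) :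
    ∀ h₂ : P₀, (∀ e ∈ Eplus, c₂ h₂ e = 0) → π (h₂, 0) = 0 := by
  intro h₂ hh₂
  have hKER : pair (π (h₂, 0)) = 0 := by
    ext s
    rw [hcompat, map_zero, hh₂ _ ((hSg s).1 s.2), zero_add]
    rfl
  obtain ⟨a, ha, x, hx⟩ := hDH _ hKER
  -- `a • π (h₂,0) = π (a • h₂, 0)` and `a • h₂ ∈ ann(Eplus)`
  have hmem : ∀ e ∈ Eplus, c₂ (a • h₂) e = 0 := fun e he ↦ by
    rw [map_smul, CharacterModule.smul_apply]; exact hh₂ _ (Eplus.smul_mem a he)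
  have hx' : π (loc' x) = π (a • h₂, 0) := by
    rw [← hx, ← map_smul, Prod.smul_mk, smul_zero]
  have hx0 : x = 0 := hS x (a • h₂) hmem hx'
  rw [hx0, map_zero, map_zero] at hx
  exact hTF a h₂ ha hx

/-- **A5″ (K0b-free necessity, S74/S75).** Same, with `𝔖⁺ = 0` weakened to «the class is `S`-torsion» (`S = Λ_𝒪`, k1-g12 `ker_iff_torsion`),
provided `loc'`, `π` commute with `S` and the images `π (t,0)` have no `S`-torsion either. -/
theorem hπker_necessary_of_torsion {S : Type u'} [Ring S] [Module S H] [Module S P₀] [Module S PS] [Module S P]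
    [SMulCommClass S A P]
    (c₂ : P₀ →ₗ[A] CharacterModule D₂) (cS : PS →ₗ[A] CharacterModule DS)
    (loc₂ : SelRel →ₗ[A] D₂) (locS : SelRel →ₗ[A] DS) (Eplus : Submodule A D₂)
    (Sg : Submodule A SelRel) (hSg : ∀ s, s ∈ Sg ↔ loc₂ s ∈ Eplus)
    (π : (P₀ × PS) →ₗ[A] P) (hπS : ∀ (b : S) (t : P₀ × PS), π (b • t) = b • π t)
    (pair : P →ₗ[A] CharacterModule Sg)
    (hcompat : ∀ (t : P₀ × PS) (s : Sg), pair (π t) s = c₂ t.1 (loc₂ s) + cS t.2 (locS s))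
    (loc' : H →ₗ[A] P₀ × PS) (hloc'S : ∀ (b : S) (x : H), loc' (b • x) = b • loc' x)
    (hTF : ∀ (a : A) (t : P₀), a ≠ 0 → a • π (t, 0) = 0 → π (t, 0) = 0)
    (hTFS : ∀ (b : S) (t : P₀), b ≠ 0 → b • π (t, 0) = 0 → π (t, 0) = 0)
    (hDH : ∀ z : P, pair z = 0 → ∃ a : A, a ≠ 0 ∧ ∃ x : H, a • z = π (loc' x))
    (hS : ∀ (x : H) (t : P₀), (∀ e ∈ Eplus, c₂ t e = 0) → π (loc' x) = π (t, 0) → ∃ b : S, b ≠ 0 ∧ b • x = 0) :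
    ∀ h₂ : P₀, (∀ e ∈ Eplus, c₂ h₂ e = 0) → π (h₂, 0) = 0 := by
  intro h₂ hh₂
  have hKER : pair (π (h₂, 0)) = 0 := by
    ext s
    rw [hcompat, map_zero, hh₂ _ ((hSg s).1 s.2), zero_add]
    rfl
  obtain ⟨a, ha, x, hx⟩ := hDH _ hKER
  have hmem : ∀ e ∈ Eplus, c₂ (a • h₂) e = 0 := fun e he ↦ by
    rw [map_smul, CharacterModule.smul_apply]; exact hh₂ _ (Eplus.smul_mem a he)
  have hx' : π (loc' x) = π (a • h₂, 0) := by
    rw [← hx, ← map_smul, Prod.smul_mk, smul_zero]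
  obtain ⟨b, hb, hbx⟩ := hS x (a • h₂) hmem hx'
  have h1 : b • (a • π (h₂, 0)) = 0 := by rw [hx, ← hπS, ← hloc'S, hbx, map_zero, map_zero]
  rw [smul_comm] at h1
  have h2 : b • π (h₂, 0) = π (b • h₂, 0) := by
    rw [← hπS, Prod.smul_mk, smul_zero]
  have h3 : b • π (h₂, 0) = 0 := by
    rw [h2] at h1 ⊢
    exact hTF a (b • h₂) ha h1
  exact hTFS b h₂ hb h3

end NecessaryTree

section FunctionalModel

variable {p : ℕ} [Fact p.Prime]

/-- **A6.** The 2-adic factor of S2 / p679036, `𝔉₂ = ((Fin n → TP) →+ ℤ_[2])`, is `ℤ₂`-torsion-free (so A2/A4 apply to it verbatim). -/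
theorem noZeroSMulDivisors_addMonoidHom (X : Type v) [AddCommGroup X] : NoZeroSMulDivisors ℤ_[p] (X →+ ℤ_[p]) := by
  refine ⟨fun {c f} h ↦ ?_⟩
  by_cases hc : c = 0
  · exact Or.inl hc
  · refine Or.inr (AddMonoidHom.ext fun x ↦ ?_)
    have hx : c * f x = 0 := by simpa using DFunLike.congr_fun h x
    simpa [hc] using hx

/-- A4 in S2's own types: `𝔉₂ := ((Fin n → X) →+ ℤ_[p])` (`X` = tower points), `N₂` any `ℤ₂`-submodule killed by the pair (S2: `ker colⁿ`). -/
theorem not_deepHalf_functionalModel {n : ℕ} {X : Type v} [AddCommGroup X] {PS : Type v} [AddCommGroup PS] [Module ℤ_[p] PS]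
    {H : Type w} [AddCommGroup H] {M : Type x} [AddCommGroup M]
    (pair : ((Fin n → X) →+ ℤ_[p]) × PS →+ M) (locd₂ : H →+ ((Fin n → X) →+ ℤ_[p])) (locdS : H →+ PS)
    (N₂ : Submodule ℤ_[p] ((Fin n → X) →+ ℤ_[p]))
    (hKER : ∀ t ∈ N₂, pair (t, 0) = 0) (hS : ∀ x : H, locd₂ x ∈ N₂ → x = 0) (ht : ∃ t ∈ N₂, t ≠ 0) :
    ¬ (∀ t : ((Fin n → X) →+ ℤ_[p]) × PS, pair t = 0 → ∃ a : ℤ_[p], a ≠ 0 ∧ ∃ x : H, a • t = (locd₂ x, locdS x)) :=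
  haveI := noZeroSMulDivisors_addMonoidHom (p := p) (Fin n → X)
  not_deepHalf_of_exists_mem_ne_zero pair locd₂ locdS N₂ hKER hS ht

end FunctionalModel

/-! ## §B  Repair socket: the signed pair DESCENDS along `colⁿ : 𝔉₂ ↠ Λⁿ` because of (KER) — `pair₂ = pairBar ∘ colⁿ` -/

section Descend

variable {F : Type v} [AddCommGroup F] {C : Type w} [AddCommGroup C] {M : Type x} [AddCommGroup M]

/-- **B1.** An additive map `p` killing the kernel of an ONTO additive map `q` factors through it: `p = pbar ∘ q`.  For S2: `p := pair₂`,
`q := colⁿ` (onto by `SignedColemanImage.colemanPlus_coeff_two` / `hondaPlus_onto_two`), the hypothesis IS the (KER) clause. -/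
theorem exists_descend_of_surjective (p : F →+ M) (q : F →+ C) (hq : Surjective q) (hKER : ∀ t, q t = 0 → p t = 0) :
    ∃ pbar : C →+ M, ∀ t : F, pbar (q t) = p t := by
  have key : ∀ t t' : F, q t = q t' → p t = p t' := fun t t' h ↦ by
    rw [← sub_eq_zero, ← map_sub]
    exact hKER _ (by rw [map_sub, h, sub_self])
  refine ⟨{ toFun := fun c ↦ p (surjInv hq c), map_zero' := ?_, map_add' := fun c c' ↦ ?_ }, fun t ↦ ?_⟩
  · rw [← map_zero p]
    exact key _ _ (by rw [surjInv_eq hq, map_zero])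
  · rw [← map_add]
    exact key _ _ (by rw [map_add, surjInv_eq hq, surjInv_eq hq, surjInv_eq hq])
  · exact key _ _ (surjInv_eq hq (q t))

/-- **B2.** The descended map is unique. -/
theorem descend_unique (q : F →+ C) (hq : Surjective q) (p₁ p₂ : C →+ M) (h : ∀ t : F, p₁ (q t) = p₂ (q t)) : p₁ = p₂ := by
  ext c
  obtain ⟨t, rfl⟩ := hq c
  exact h t

/-- **B3 ((LIN) descends).** If `p (c • t) = φ c (p t)` (S2 (LIN): `pair₂ (c • t) s = pair₂ t (ι c • s)`, i.e. `φ c` = precomposition with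
`ι c • ·`) and `q` commutes with the scalars, then `pbar (c • y) = φ c (pbar y)` — the N5 binder `hpair` for the descended pair. -/
theorem descend_lin {R : Type u} [SMul R F] [SMul R C] (p : F →+ M) (q : F →+ C) (hq : Surjective q)
    (pbar : C →+ M) (hbar : ∀ t : F, pbar (q t) = p t) (φ : R → M → M)
    (hLIN : ∀ (c : R) (t : F), p (c • t) = φ c (p t)) (hq_smul : ∀ (c : R) (t : F), q (c • t) = c • q t)
    (c : R) (y : C) : pbar (c • y) = φ c (pbar y) := by
  obtain ⟨t, rfl⟩ := hq y
  rw [← hq_smul, hbar, hbar, hLIN]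

/-- **B4 ((EH_Z) descends).** `p (locd₂ x) = 0 → pbar ((q ∘ locd₂) x) = 0` — with `q ∘ locd₂ = 𝒸` this is the (EH_Z) binder in the reduced currency. -/
theorem descend_EH {H : Type u} [AddCommGroup H] (p : F →+ M) (q : F →+ C) (pbar : C →+ M)
    (hbar : ∀ t : F, pbar (q t) = p t) (locd₂ : H →+ F) (x : H) (hEH : p (locd₂ x) = 0) :
    pbar ((q.comp locd₂) x) = 0 := by
  simpa [hbar] using hEH

/-- **B5 (ORTH descends).** `(∀ t, p t s = 0) → ∀ y, pbar y s = 0` for character-valued pairs (`M = Sel → ℚ/ℤ`-like function types). -/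
theorem descend_orth {Sel V : Type*} [AddCommGroup V] (p : F →+ (Sel → V)) (q : F →+ C) (hq : Surjective q)
    (pbar : C →+ (Sel → V)) (hbar : ∀ t : F, pbar (q t) = p t) (s : Sel) (horth : ∀ t : F, p t s = 0) (y : C) :
    pbar y s = 0 := by
  obtain ⟨t, rfl⟩ := hq y
  rw [hbar]
  exact horth t

end Descend

section CoordinateKernel

variable {p : ℕ} [Fact p.Prime] {X : Type v} [AddCommGroup X] {C : Type w} [AddCommGroup C]

/-- S2's coordinatewise map `t ↦ (col (t ∘ single i))_i` (`𝒸 = colⁿ ∘ locd₂` of V2A §2) as ONE additive map `𝔉₂ → Cⁿ`. Its kernel is literally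
the (KER) antecedent `∀ i, col (t ∘ single i) = 0` (B6) and it is onto when `col` is (B7) — so B1 applies with `q := coordCol`. -/
theorem coordCol_apply_eq_zero_iff {n : ℕ} (col : (X →+ ℤ_[p]) →+ C) (t : (Fin n → X) →+ ℤ_[p]) :
    (fun i : Fin n ↦ col (t.comp (AddMonoidHom.single (fun _ : Fin n ↦ X) i))) = 0 ↔
      ∀ i, col (t.comp (AddMonoidHom.single (fun _ : Fin n ↦ X) i)) = 0 :=
  funext_iff

/-- **B7.** `colⁿ` is onto when `col` is: given `(c_i)`, take `t := Σ_i t_i ∘ proj_i` with `col t_i = c_i`. -/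
theorem exists_coord_preimage {n : ℕ} (col : (X →+ ℤ_[p]) →+ C) (hcol : Surjective col) (c : Fin n → C) :
    ∃ t : (Fin n → X) →+ ℤ_[p], ∀ i, col (t.comp (AddMonoidHom.single (fun _ : Fin n ↦ X) i)) = c i := by
  classical
  choose s hs using fun i ↦ hcol (c i)
  refine ⟨∑ i, (s i).comp (Pi.evalAddMonoidHom (fun _ : Fin n ↦ X) i), fun i ↦ ?_⟩
  have hcomp : (∑ j, (s j).comp (Pi.evalAddMonoidHom (fun _ : Fin n ↦ X) j)).comp
      (AddMonoidHom.single (fun _ : Fin n ↦ X) i) = s i := by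
    ext x
    simp only [AddMonoidHom.coe_comp, AddMonoidHom.finsetSum_apply, Function.comp_apply,
      Pi.evalAddMonoidHom_apply, AddMonoidHom.single_apply]
    rw [Finset.sum_eq_single i]
    · simp
    · intro j _ hj
      simp [Pi.single_eq_of_ne hj]
    · simp
  rw [hcomp, hs]

end CoordinateKernel

section DescendTree

/-! ### §B in the TREE's currency: the `pair`/`hcompat` binders of `deepHalfSigma_of_relaxed` CONSTRUCTED by descent along `π`. -/

variable {A : Type u} [CommRing A]

/-- **B8 (linear descent).** `ker q ≤ ker p`, `q` onto ⟹ `p = pbar ∘ q`. -/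
theorem exists_linear_descend {F C M : Type v} [AddCommGroup F] [Module A F] [AddCommGroup C] [Module A C]
    [AddCommGroup M] [Module A M] (p : F →ₗ[A] M) (q : F →ₗ[A] C) (hq : Surjective q)
    (hKER : LinearMap.ker q ≤ LinearMap.ker p) : ∃ pbar : C →ₗ[A] M, ∀ t : F, pbar (q t) = p t := by
  refine ⟨(LinearMap.ker q).liftQ p hKER ∘ₗ (q.quotKerEquivOfSurjective hq).symm.toLinearMap, fun t ↦ ?_⟩
  have h : (q.quotKerEquivOfSurjective hq).symm (q t) = Submodule.Quotient.mk t := by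
    rw [LinearEquiv.symm_apply_eq]
    rfl
  simp [h]

variable {P₀ PS D₂ DS P SelRel : Type v}
  [AddCommGroup P₀] [Module A P₀] [AddCommGroup PS] [Module A PS] [AddCommGroup D₂] [Module A D₂]
  [AddCommGroup DS] [Module A DS] [AddCommGroup P] [Module A P] [AddCommGroup SelRel] [Module A SelRel]

/-- **B9 (the `pair`/`hcompat` socket).** For ANY onto coarsening `π` whose kernel pairs to zero with the strict classes, the binder
`pair : P →ₗ[A] CharacterModule Sg` of `deepHalfSigma_of_relaxed` EXISTS with `hcompat` — it is the descent of the relaxed local character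
`(t₂,t_S) ↦ (s ↦ ⟨t₂, loc₂ s⟩₂ + ⟨t_S, loc_S s⟩_S)` restricted to `Sg`.  (With `π = colⁿ × id` and S2's VAL this is `pairBar ⊕ pins`.) -/
theorem exists_pair_hcompat
    (c₂ : P₀ →ₗ[A] CharacterModule D₂) (cS : PS →ₗ[A] CharacterModule DS)
    (loc₂ : SelRel →ₗ[A] D₂) (locS : SelRel →ₗ[A] DS) (Sg : Submodule A SelRel)
    (π : (P₀ × PS) →ₗ[A] P) (hπ : Surjective π)
    (hker : ∀ t : P₀ × PS, π t = 0 → ∀ s : Sg, c₂ t.1 (loc₂ s) + cS t.2 (locS s) = 0) :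
    ∃ pair : P →ₗ[A] CharacterModule Sg,
      ∀ (t : P₀ × PS) (s : Sg), pair (π t) s = c₂ t.1 (loc₂ s) + cS t.2 (locS s) := by
  let toChar : (P₀ × PS) →ₗ[A] CharacterModule (D₂ × DS) :=
    CharacterModule.dual (LinearMap.fst A D₂ DS) ∘ₗ c₂ ∘ₗ LinearMap.fst A P₀ PS +
      CharacterModule.dual (LinearMap.snd A D₂ DS) ∘ₗ cS ∘ₗ LinearMap.snd A P₀ PS
  have htoChar : ∀ (t : P₀ × PS) (x : D₂ × DS), toChar t x = c₂ t.1 x.1 + cS t.2 x.2 := fun _ _ ↦ rfl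
  let pair' : (P₀ × PS) →ₗ[A] CharacterModule Sg := CharacterModule.dual ((loc₂.prod locS) ∘ₗ Sg.subtype) ∘ₗ toChar
  have hpair' : ∀ (t : P₀ × PS) (s : Sg), pair' t s = c₂ t.1 (loc₂ s) + cS t.2 (locS s) := fun _ _ ↦ rfl
  have hle : LinearMap.ker π ≤ LinearMap.ker pair' := by
    intro t ht
    rw [LinearMap.mem_ker] at ht ⊢
    ext s
    rw [hpair']
    exact hker t ht s
  obtain ⟨pbar, hbar⟩ := exists_linear_descend pair' π hπ hle
  exact ⟨pbar, fun t s ↦ by rw [hbar, hpair']⟩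

/-- **B10 (when the forced kernel is admissible).** If `ker π ≤ ann(Eplus) × 0` (the CONVERSE inclusion to `hπker`) and the strict classes are
plus at 2 (`hSg`), the hypothesis `hker` of B9 holds.  With A5′: `ker π = ann(Eplus) × 0` is admissible AND minimal — the entry currency is
`P = P₀ ⧸ ann(Eplus) × P_S` (`≅ Λⁿ × P_S` by `colemanPlus_coeff_two`), forced, not chosen. -/
theorem hker_of_le_annProd
    (c₂ : P₀ →ₗ[A] CharacterModule D₂) (cS : PS →ₗ[A] CharacterModule DS)
    (loc₂ : SelRel →ₗ[A] D₂) (locS : SelRel →ₗ[A] DS) (Eplus : Submodule A D₂)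
    (Sg : Submodule A SelRel) (hSg : ∀ s, s ∈ Sg ↔ loc₂ s ∈ Eplus)
    (π : (P₀ × PS) →ₗ[A] P)
    (hπle : ∀ t : P₀ × PS, π t = 0 → t.2 = 0 ∧ ∀ e ∈ Eplus, c₂ t.1 e = 0) :
    ∀ t : P₀ × PS, π t = 0 → ∀ s : Sg, c₂ t.1 (loc₂ s) + cS t.2 (locS s) = 0 := by
  intro t ht s
  obtain ⟨h2, h1⟩ := hπle t ht
  rw [h2, map_zero, h1 _ ((hSg s).1 s.2), zero_add]
  rfl

/-- **B11 (the two inclusions meet).** Under `hπker` (tree, sufficient) AND `hπle` (B10), `ker π` restricted to the 2-adic factor IS `ann(Eplus)`: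
`π (h₂, 0) = 0 ↔ ∀ e ∈ Eplus, c₂ h₂ e = 0`. -/
theorem ker_inl_iff
    (c₂ : P₀ →ₗ[A] CharacterModule D₂) (Eplus : Submodule A D₂) (π : (P₀ × PS) →ₗ[A] P)
    (hπker : ∀ h₂ : P₀, (∀ e ∈ Eplus, c₂ h₂ e = 0) → π (h₂, 0) = 0)
    (hπle : ∀ t : P₀ × PS, π t = 0 → t.2 = 0 ∧ ∀ e ∈ Eplus, c₂ t.1 e = 0) (h₂ : P₀) :
    π (h₂, 0) = 0 ↔ ∀ e ∈ Eplus, c₂ h₂ e = 0 :=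
  ⟨fun h ↦ (hπle _ h).2, hπker h₂⟩

/-- **B12 (the forced currency, packaged).** With `N = ann(Eplus) ≤ P₀` and `π := mk_N × id : P₀ × P_S ↠ (P₀ ⧸ N) × P_S` (the cut of
`SKELETON-V2-CUT-g16` l. 55), ALL the coarsening binders of `deepHalfSigma_of_relaxed` are discharged: `π` onto, `hπker`, and the `pair` with
`hcompat` (by B9/B10).  What remains for the assembly is only `hDHrel` (place cut, p684598) and the N5 counts — on `(P₀ ⧸ N) × P_S ≅ Λⁿ × P_S`. -/
theorem forcedCurrency_package
    (c₂ : P₀ →ₗ[A] CharacterModule D₂) (cS : PS →ₗ[A] CharacterModule DS)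
    (loc₂ : SelRel →ₗ[A] D₂) (locS : SelRel →ₗ[A] DS) (Eplus : Submodule A D₂)
    (Sg : Submodule A SelRel) (hSg : ∀ s, s ∈ Sg ↔ loc₂ s ∈ Eplus)
    (N : Submodule A P₀) (hN : ∀ h₂, h₂ ∈ N ↔ ∀ e ∈ Eplus, c₂ h₂ e = 0) :
    Surjective (N.mkQ.prodMap (LinearMap.id : PS →ₗ[A] PS)) ∧
    (∀ h₂ : P₀, (∀ e ∈ Eplus, c₂ h₂ e = 0) → N.mkQ.prodMap (LinearMap.id : PS →ₗ[A] PS) (h₂, 0) = 0) ∧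
    ∃ pair : ((P₀ ⧸ N) × PS) →ₗ[A] CharacterModule Sg,
      ∀ (t : P₀ × PS) (s : Sg), pair (N.mkQ.prodMap LinearMap.id t) s = c₂ t.1 (loc₂ s) + cS t.2 (locS s) := by
  have hπ : Surjective (N.mkQ.prodMap (LinearMap.id : PS →ₗ[A] PS)) := by
    rintro ⟨y, u⟩
    obtain ⟨t, rfl⟩ := Submodule.mkQ_surjective N y
    exact ⟨(t, u), rfl⟩
  refine ⟨hπ, fun h₂ hh₂ ↦ ?_, ?_⟩
  · rw [LinearMap.prodMap_apply, LinearMap.id_apply, Prod.mk_eq_zero]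
    exact ⟨(Submodule.Quotient.mk_eq_zero N).2 ((hN h₂).2 hh₂), rfl⟩
  · refine exists_pair_hcompat c₂ cS loc₂ locS Sg _ hπ
      (hker_of_le_annProd c₂ cS loc₂ locS Eplus Sg hSg _ fun t ht ↦ ?_)
    rw [LinearMap.prodMap_apply, LinearMap.id_apply, Prod.mk_eq_zero] at ht
    exact ⟨ht.2, (hN t.1).1 ((Submodule.Quotient.mk_eq_zero N).1 ht.1)⟩

end DescendTree

/-! ## §C  On the reduced currency the 2-adic count IS S3's `(i_D)`/`(nz⁺)`; coarsening further only lowers the count -/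

section Transfer

variable {R : Type u} [CommRing R] {F : Type v} [AddCommGroup F] [Module R F] {C : Type v} [AddCommGroup C] [Module R C]

/-- **C1.** `𝔉 ⧸ (L ⊔ ker q) ≃ C ⧸ q(L)` for `q` onto. -/
theorem nonempty_quotSupKer_equiv (q : F →ₗ[R] C) (hq : Surjective q) (L : Submodule R F) :
    Nonempty ((F ⧸ (L ⊔ LinearMap.ker q)) ≃ₗ[R] (C ⧸ L.map q)) := by
  have hsurj : Surjective ((L.map q).mkQ ∘ₗ q) := (Submodule.mkQ_surjective _).comp hq
  have hker : LinearMap.ker ((L.map q).mkQ ∘ₗ q) = L ⊔ LinearMap.ker q := by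
    rw [LinearMap.ker_comp, Submodule.ker_mkQ, Submodule.comap_map_eq]
  exact ⟨(Submodule.quotEquivOfEq _ _ hker.symm).trans (LinearMap.quotKerEquivOfSurjective _ hsurj)⟩

/-- **C2.** With `K := ker q`: `(𝔉 ⧸ K) ⧸ L̄ ≃ C ⧸ q(L)`, `L̄ := L.map mk` (third isomorphism theorem) — for an entry typed as `P₂ := 𝔉₂ ⧸ ann((⨆E⁺)ⁿ)`
(SKELETON-V2-CUT l. 55) rather than `P₂ := Λⁿ`: same numbers, since `ann((⨆E⁺)ⁿ) = ker colⁿ` (`colemanPlus_coeff_two`). -/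
theorem nonempty_reduced_equiv (q : F →ₗ[R] C) (hq : Surjective q) (L : Submodule R F) :
    Nonempty ((((F ⧸ LinearMap.ker q) ⧸ L.map (LinearMap.ker q).mkQ)) ≃ₗ[R] (C ⧸ L.map q)) := by
  obtain ⟨e₂⟩ := nonempty_quotSupKer_equiv q hq L
  exact ⟨(Submodule.quotientQuotientEquivQuotientSup (LinearMap.ker q) L).trans
    ((Submodule.quotEquivOfEq _ _ (sup_comm _ _)).trans e₂)⟩

/-- **C3.** `q(span (locd₂ '' Z)) = span (𝒸 '' Z)` with `𝒸 = q ∘ locd₂` — the reduced 2-adic sublattice IS S3's `span (𝒸 '' Λ_𝒪 z)`. -/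
theorem map_span_image {H : Type w} (q : F →ₗ[R] C) (locd₂ : H → F) (Z : Set H) :
    (Submodule.span R (locd₂ '' Z)).map q = Submodule.span R ((fun x ↦ q (locd₂ x)) '' Z) := by
  rw [Submodule.map_span, Set.image_image]

variable (K' : Type w) [Field K'] [Algebra R K']

open scoped TensorProduct

theorem finite_baseChange_iff_of_equiv {X Y : Type v} [AddCommGroup X] [Module R X] [AddCommGroup Y] [Module R Y]
    (e : X ≃ₗ[R] Y) : Module.Finite K' (K' ⊗[R] X) ↔ Module.Finite K' (K' ⊗[R] Y) :=
  ⟨fun _ ↦ Module.Finite.equiv (LinearEquiv.baseChange R K' X Y e),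
   fun _ ↦ Module.Finite.equiv (LinearEquiv.baseChange R K' X Y e).symm⟩

theorem finrank_baseChange_eq_of_equiv {X Y : Type v} [AddCommGroup X] [Module R X] [AddCommGroup Y] [Module R Y]
    (e : X ≃ₗ[R] Y) : Module.finrank K' (K' ⊗[R] X) = Module.finrank K' (K' ⊗[R] Y) :=
  LinearEquiv.finrank_eq (LinearEquiv.baseChange R K' X Y e)

/-- **C4 (COUNT/FIN transfer).** The reduced 2-adic quotient and S3's `Q = C ⧸ q(L)` have the same `K'`-dimension after base change and are finite
together: `(nz⁺)` IS `hfinP`'s 2-adic share and `(i_D)` IS the 2-adic COUNT. -/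
theorem finrank_reduced_eq (q : F →ₗ[R] C) (hq : Surjective q) (L : Submodule R F) :
    Module.finrank K' (K' ⊗[R] ((F ⧸ LinearMap.ker q) ⧸ L.map (LinearMap.ker q).mkQ)) =
      Module.finrank K' (K' ⊗[R] (C ⧸ L.map q)) ∧
    (Module.Finite K' (K' ⊗[R] ((F ⧸ LinearMap.ker q) ⧸ L.map (LinearMap.ker q).mkQ)) ↔
      Module.Finite K' (K' ⊗[R] (C ⧸ L.map q))) := by
  obtain ⟨e⟩ := nonempty_reduced_equiv q hq L
  exact ⟨finrank_baseChange_eq_of_equiv K' e, finite_baseChange_iff_of_equiv K' e⟩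

/-- **C5 (optimality: coarsening only LOWERS the count).** For any onto `σ : P → P̄` and sublattice `L ≤ P`:
`λ(P̄ ⧸ σ L) ≤ λ(P ⧸ L)` (and finiteness transfers).  With A5: `ker π = ker colⁿ × 0` is the unique optimal admissible currency —
finer is refutable, coarser is weaker.  (The case `σ = id`, `L ≤ L'` is k1-g5 M1 `finrank_baseChange_quotient_anti`.) -/
theorem finrank_baseChange_quotient_coarsen_le {P Pb : Type v} [AddCommGroup P] [Module R P] [AddCommGroup Pb] [Module R Pb]
    (σ : P →ₗ[R] Pb) (hσ : Surjective σ) (L : Submodule R P) [Module.Finite K' (K' ⊗[R] (P ⧸ L))] :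
    Module.Finite K' (K' ⊗[R] (Pb ⧸ L.map σ)) ∧
      Module.finrank K' (K' ⊗[R] (Pb ⧸ L.map σ)) ≤ Module.finrank K' (K' ⊗[R] (P ⧸ L)) := by
  set τ : (P ⧸ L) →ₗ[R] (Pb ⧸ L.map σ) := L.mapQ (L.map σ) σ (fun x hx ↦ Submodule.mem_map_of_mem hx) with hτ
  have hτs : Surjective τ := by
    intro y
    induction y using Submodule.Quotient.induction_on with
    | H b =>
      obtain ⟨a, rfl⟩ := hσ b
      exact ⟨Submodule.Quotient.mk a, by simp [hτ]⟩
  have hs : Surjective (τ.baseChange K') := by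
    rw [LinearMap.baseChange_eq_ltensor]
    exact LinearMap.lTensor_surjective K' hτs
  refine ⟨Module.Finite.of_surjective _ hs, ?_⟩
  calc Module.finrank K' (K' ⊗[R] (Pb ⧸ L.map σ))
      = Module.finrank K' (LinearMap.range (τ.baseChange K')) := by
        rw [LinearMap.range_eq_top.mpr hs, finrank_top]
    _ ≤ Module.finrank K' (K' ⊗[R] (P ⧸ L)) := LinearMap.finrank_range_le _

end Transfer

end Summit.BirchSwinnertonDyer.BirchSwinnertonDyer.Cruxes.ResidualThetaCountLowerPureAtTwo.SideaK4G15
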